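import Mathlib
import HarnessLib
import Summits.HubbardSuperconductivity.HubbardSuperconductivity.Theorems.WeakCouplingBCSKlCertTPrimeShellVolumePolar
import Summits.HubbardSuperconductivity.HubbardSuperconductivity.Theorems.WeakCouplingBCSKlCertTPrimeTorusSublevel
import Summits.HubbardSuperconductivity.HubbardSuperconductivity.Theorems.WeakCouplingBCSKlCertTPrimePocketConvexGeom
import Summits.HubbardSuperconductivity.HubbardSuperconductivity.Theorems.WeakCouplingBCSKlCertTPm03HSTransport

/-!
# Route `WeakCouplingBCS` — certificate half of stmt-HubbardSuperconductivity-0158, item «CONVEX-WINDOW-HS», file S2: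
# THE `χ₀` HILBERT–SCHMIDT ROW IS A THEOREM AT EVERY STRICTLY CONVEX CELL of the `t`–`t′` band — Γ-pockets and, by the particle–hole map, M-pockets

Cell `gate-hubbard-kl`, seat p4 (g24); zero kit; no definitions.  Assembly of the five inputs of ✓ `klg_memLp_kernel_of_geometry` on the Γ-window
`|t′| < 1/2`, `−4 − 4t′ < μ < 4t′`, all of which are now theorems: the chart `kltpPolar` is continuous (✓ `continuous_kltpPolar`) and dominates the
Fermi-curve measure (✓ `kltp_fermiCurveMeasure_le_map_polar`, margin-1 g18), the torus sublevel estimate holds under strict convexity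
(✓ `kltp_exists_torusSublevel_le`, F3b, with ✓ `kltp_exists_angle_of_level`), the shell volume is `O(t)` (✓ `kltp_exists_shellVolume_le`, S1) and the
level set is null (✓ `kltp_volume_levelSet`):

* **`kltp_HS_of_convex (htp) (hμ₁) (hμ₂) (hN)`** — Γ side: `0 < curvNum t′` along the chart ⇒ `χ₀[ε_{t′}, μ](· + ·) ∈ L²(σ ⊗ σ)`;
  `kltp_HS_of_convex'` — the same keyed on `0 < curvNum` at every point of the Fermi curve;
* **`kltp_HS_of_convex_reflected`** — M side: the HS row of `(t′, μ)` from strict convexity of the REFLECTED Γ-pocket `(−t′, −μ)`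
  (✓ `kltp_memLp_kernel_of_reflected`, margin-1 g18; finiteness of both measures is a theorem);
* **`kltp_HS_Mside (htp1 : −1/2 < t′) (htp0 : t′ < 0) (hvh : 4t′ < μ) (htop : μ < 4 − 4t′) (hdisc : μ − 4t′ < 32|t′|(1 − 4t′²))`** — the HS row at EVERY
  M-SIDE CONVEX CELL OF KL-MARGIN-SCAN with NO analytic hypothesis (convexity ✓ `kltp_curvNum_pos_of_reflected_Mside` ⇐ `Mside_curvNum_neg`);
  the `(⅛, −3/10)` row `kltp_m03_HS` (F4) is its instance.

HONEST LABEL: Hilbert–Schmidt rows only; any record built on them stays conditional on its certified enclosures; nothing DECIDED moves; nothing about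
`K₃`, `U₀`, the window or superconductivity; a Kohn–Luttinger `O(U²)` channel statement is not ODLRO; nothing here proves superconductivity in the
Hubbard model.
References: S. Raghu, S. A. Kivelson, D. J. Scalapino, Phys. Rev. B 81 (2010) 224505, §II (5)–(8); E. M. Stein, *Singular Integrals and
Differentiability Properties of Functions* (1970), App. A.1; E. M. Stein, *Harmonic Analysis* (1993), Ch. VIII §1.
-/

noncomputable section

-- the tree's namespace `Summit.<Summit>.<Problem>.Theorems` repeats the summit name by design (D-0017)
set_option linter.dupNamespace false

namespace Summit.HubbardSuperconductivity.HubbardSuperconductivity.Theorems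

open Real Set Filter MeasureTheory Literature.MathematicalPhysics.QuantumLattice KlTPrimeConvexity
open scoped Topology ENNReal

/-! ### §1 Γ-pockets -/

section Window

variable {tp μ : ℝ} (htp : |tp| < 1 / 2) (hμ₁ : -4 - 4 * tp < μ) (hμ₂ : μ < 4 * tp)
include htp hμ₁ hμ₂

/-- **THE HILBERT–SCHMIDT ROW AT EVERY STRICTLY CONVEX Γ-POCKET**: for `|t′| < 1/2`, `−4 − 4t′ < μ < 4t′` and `0 < curvNum t′` along the polar chart,
`χ₀[ε_{t′}, μ](· + ·) ∈ L²(σ[ε_{t′}, μ] ⊗ σ[ε_{t′}, μ])`. [cite: SteinSingularIntegrals1970, App. A.1] -/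
theorem kltp_HS_of_convex (hN : ∀ θ : ℝ, 0 < curvNum tp (kltpX tp μ θ) (kltpY tp μ θ)) :
    MemLp (fun z : Momentum × Momentum => lindhardFunction (squareDispersion 1 tp) μ (z.1 + z.2)) 2
      ((fermiCurveMeasure (squareDispersion 1 tp) μ).prod (fermiCurveMeasure (squareDispersion 1 tp) μ)) := by
  obtain ⟨w₁, -, hσ⟩ := kltp_fermiCurveMeasure_le_map_polar htp hμ₁ hμ₂
  obtain ⟨C, β, hC, hβ0, hβ2, hTSL⟩ :=
    kltp_exists_torusSublevel_le htp hμ₁ hμ₂ hN (fun X Y h => kltp_exists_angle_of_level htp hμ₁ hμ₂ h)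
  obtain ⟨Csh, hCsh, hSV⟩ := kltp_exists_shellVolume_le htp hμ₁ hμ₂
  exact klg_memLp_kernel_of_geometry (continuous_squareDispersion 1 tp) (continuous_kltpPolar htp hμ₁ hμ₂) μ hσ hC hβ0 hβ2 hCsh hTSL hSV
    (kltp_volume_levelSet tp htp μ)

/-- The same, keyed on strict convexity at every point of the Fermi curve (`0 < curvNum t′ (k 0) (k 1)` for `k ∈ F`). [cite: SteinSingularIntegrals1970, App. A.1] -/
theorem kltp_HS_of_convex' (hN : ∀ k ∈ fermiCurve (squareDispersion 1 tp) μ, 0 < curvNum tp (k 0) (k 1)) :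
    MemLp (fun z : Momentum × Momentum => lindhardFunction (squareDispersion 1 tp) μ (z.1 + z.2)) 2
      ((fermiCurveMeasure (squareDispersion 1 tp) μ).prod (fermiCurveMeasure (squareDispersion 1 tp) μ)) := by
  refine kltp_HS_of_convex htp hμ₁ hμ₂ fun θ => ?_
  have h := hN _ (kltpPolar_mem_fermiCurve htp hμ₁ hμ₂ θ)
  rwa [kltpPolar_apply_zero', kltpPolar_apply_one'] at h

end Window

/-! ### §2 M-pockets, by the particle–hole map -/

/-- **The HS row of `(t′, μ)` from strict convexity of the REFLECTED Γ-pocket `(−t′, −μ)`** (`−4 + 4t′ < −μ < −4t′`): the Γ-side theorem transported by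
✓ `kltp_memLp_kernel_of_reflected`; both Fermi-curve measures are finite (Γ side by the chart, M side as its push-forward). [cite: RaghuKivelsonScalapino2010, §II (5)-(8)] -/
theorem kltp_HS_of_convex_reflected {tp μ : ℝ} (htp : |tp| < 1 / 2) (hμ₁ : -4 - 4 * (-tp) < -μ) (hμ₂ : -μ < 4 * (-tp))
    (hN : ∀ k ∈ fermiCurve (squareDispersion 1 (-tp)) (-μ), 0 < curvNum (-tp) (k 0) (k 1)) :
    MemLp (fun z : Momentum × Momentum => lindhardFunction (squareDispersion 1 tp) μ (z.1 + z.2)) 2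
      ((fermiCurveMeasure (squareDispersion 1 tp) μ).prod (fermiCurveMeasure (squareDispersion 1 tp) μ)) := by
  have htp' : |(-tp)| < 1 / 2 := by rwa [abs_neg]
  have hΓ := kltp_HS_of_convex' htp' hμ₁ hμ₂ hN
  haveI hfin' : IsFiniteMeasure (fermiCurveMeasure (squareDispersion 1 (-tp)) (-μ)) := kltp_isFiniteMeasure_polar htp' hμ₁ hμ₂
  haveI : IsFiniteMeasure (fermiCurveMeasure (squareDispersion 1 tp) μ) := by
    rw [← (klph_measurePreserving_shift_fermiCurveMeasure tp μ).map_eq]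
    infer_instance
  exact kltp_memLp_kernel_of_reflected tp μ hΓ

/-- **THE `χ₀` HILBERT–SCHMIDT ROW AT EVERY M-SIDE CONVEX CELL OF KL-MARGIN-SCAN**, hypothesis-free: for `−1/2 < t′ < 0` and
`4t′ < μ < min(4 − 4t′, 4t′ + 32|t′|(1 − 4t′²))` (the M-pocket window intersected with the convexity band of `Mside_curvNum_neg`),
`χ₀[ε_{t′}, μ](· + ·) ∈ L²(σ ⊗ σ)`.  The `(⅛, −3/10)` row `kltp_m03_HS` is the instance `t′ = −3/10`, `μ ∈ [−1, −9/10]`.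
[cite: RaghuKivelsonScalapino2010, §II (5)-(8)] -/
theorem kltp_HS_Mside {tp μ : ℝ} (htp1 : -1 / 2 < tp) (htp0 : tp < 0) (hvh : 4 * tp < μ) (htop : μ < 4 - 4 * tp)
    (hdisc : μ - 4 * tp < 32 * |tp| * (1 - 4 * tp ^ 2)) :
    MemLp (fun z : Momentum × Momentum => lindhardFunction (squareDispersion 1 tp) μ (z.1 + z.2)) 2
      ((fermiCurveMeasure (squareDispersion 1 tp) μ).prod (fermiCurveMeasure (squareDispersion 1 tp) μ)) := by
  have htp : |tp| < 1 / 2 := abs_lt.2 ⟨by linarith, by linarith⟩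
  refine kltp_HS_of_convex_reflected htp (by linarith) (by linarith) fun k hk => ?_
  have hdisc' : 4 * (-tp) - (-μ) < 32 * |(-tp)| * (1 - 4 * (-tp) ^ 2) := by
    rw [abs_neg, neg_sq]; linarith
  exact kltp_curvNum_pos_of_reflected_Mside (by linarith) (by linarith) (by linarith) hdisc' hk.2

end Summit.HubbardSuperconductivity.HubbardSuperconductivity.Theorems

end
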